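/-
Copyright (c) 2026. All rights reserved.
Released under Apache 2.0 license as described in the file LICENSE.
-/
import Summits.Langlands.Langlands.Theorems.SoloInformedKzeroDegreeArtin
import HarnessLib

/-!
# `charpoly (φ_D^f | D_cris(𝟙_m)) = (X - 1)^{m·f}` at absolutely unramified places (solo programme, rung Λ10)

Solo/informed seat, statement repair D2-cris.  The clause `D2Cris.CrystallineCompatibleAt` (file
`SoloInformedRepairD2Cris`) predicts, for `ρ|Γ_{K_v}` at a place `v ∣ ℓ` where `π_v` has Satake parameter `α`,
a `ℚ̄_ℓ`-basis `b` of `D_cris(ρ|Γ_{K_v})` — over the CONSTRUCTED `B_max(K_v) = A_max[1/t]` — of size `n · f(v|ℓ)`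
with `charpoly (toMatrix b b (φ_D ^ f)) = (∏_{a ∈ α} (X - ι⁻¹ a)) ^ f`.  For the TRIVIAL representation `𝟙_m`
(parameter `α = {1, …, 1}`, `geomFrobPolyOfSatake ι α = (X - 1)^m`) the prediction reads:
`∃ b : Basis (Fin (m·f)), charpoly (toMatrix b b (φ_D^f)) = (X - 1)^{m·f}`.

Rung Λ9 (`SoloInformedKzeroDegreeArtin`) made the RANK half `dim D_cris(𝟙_m) = m·f` a kernel theorem at every
absolutely unramified `p`-adic field `F` (`p` a uniformiser, `q_F = p^f`), input-free.  This file closes the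
CHARACTERISTIC-POLYNOMIAL half at the same places, input-free:

* §1 (abstract `B`, `φ`, `Γ`): `phiTensor_pow_tmul`, `coe_phiD_pow`, and ★ `phiD_pow_eq_one_of_trivial`: if
  `φ^f = id` on `B^Γ` then `φ_D^f = 1` on `D(𝟙_m) = (E^m ⊗_{ℚ_p} B)^Γ` (Λ8a `invariants_eq_span_of_trivial`:
  `D(𝟙_m)` is the `E`-span of the `e_k ⊗ w`, `w ∈ B^Γ`); `charpoly_toMatrix_phiD_pow_of_trivial` (any finite basis).
* §2 (`B = B_max(F)`): ★ `phiDcris_pow_eq_one_of_unramified`: `φ_D^f = 1` on `D_cris(𝟙_m)` for absolutely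
  unramified `F` (Λ9 `frobBmax_iterate_eq_self_of_unramified`: `φ^f = id` on `B_max(F)^{Γ_F} = K₀`);
  ★★ `exists_basis_charpoly_phiDcris_pow_of_unramified`: a basis of size `m·f` with
  `charpoly (φ_D^f) = (X - 1)^{m·f}` — with Λ9's rank theorem, the FULL `𝟙_m` instance of the conclusion of
  `CrystallineCompatibleAt` (`geomFrobPolyOfSatake_replicate_one`,
  `exists_basis_charpoly_eq_geomFrobPolyOfSatake_pow_of_unramified`), and the input-free primed forms (`θ`
  surjective and the two `F^nr` instance facts discharged from `valuation F p < 1`).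

Not proved here (scope): the same at RAMIFIED `F` (`e > 1`), where `B_max(F)^{Γ_F} = F₀` needs Colmez's
`t`-divisibility criterion (rung Λ5, binder `hTC`) — the `e = 1` mechanism (`𝒪̂_{F^nr} = W(k̄)`) does not extend.

References: Fontaine, Astérisque 223 (1994), Exp. III §1.3–§1.5, Exp. VIII §2.3.7; Colmez, Ann. of Math. 148
(1998), §III.2; Buzzard–Gee, *The conjectural connections between automorphic representations and Galois
representations* (2014), Conj. 3.2.2.
-/

noncomputable section

open scoped MatrixGroups TensorProduct ValuativeRel Polynomial
open WittVector Field IsLocalRing ValuativeRel Polynomial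
open Literature.NumberTheory.GaloisRepresentations Literature.NumberTheory.PAdicHodge
open Literature.NumberTheory.GaloisRepresentations.IsNonarchimedeanLocalField

namespace Summit.Langlands.Langlands.Theorems

namespace D2Cris

/-! ### §1 `φ_D^f = 1` on `D(𝟙_m)` when `φ^f = id` on `B^Γ` (abstract `B`, `φ`, `Γ`) -/

section Abstract

variable {p : ℕ} [Fact p.Prime] {E : Type*} [Field E] [Algebra ℚ_[p] E]
  {Γ : Type*} {B : Type*} [CommRing B] [Algebra ℚ_[p] B] {m : ℕ}

/-- `(1 ⊗ φ)^k (v ⊗ b) = v ⊗ φ^k b` on `E^m ⊗_{ℚ_p} B`. [cite: FontaineAsterisque223III, Exp. III §1.3] -/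
theorem phiTensor_pow_tmul (φ : B →ₐ[ℚ_[p]] B) (k : ℕ) (v : Fin m → E) (b : B) :
    (phiTensor (E := E) (m := m) φ ^ k) (v ⊗ₜ[ℚ_[p]] b) = v ⊗ₜ[ℚ_[p]] ((φ : B → B)^[k] b) := by
  induction k with
  | zero => rw [pow_zero, Module.End.one_apply, Function.iterate_zero_apply]
  | succ k ih =>
    rw [pow_succ', Module.End.mul_apply, ih, Function.iterate_succ_apply']
    simp only [phiTensor, TensorProduct.AlgebraTensorModule.map_tmul, LinearMap.id_apply, AlgHom.toLinearMap_apply]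

/-- Underlying tensor of `φ_D^k x`: `(1 ⊗ φ)^k x`. [folklore] -/
theorem coe_phiD_pow (ρ : Γ → GL (Fin m) E) (gal : Γ → (B →ₐ[ℚ_[p]] B)) (φ : B →ₐ[ℚ_[p]] B)
    (hφ : ∀ σ, (gal σ).comp φ = φ.comp (gal σ)) (k : ℕ) (x : invariants ρ gal) :
    (((phiD ρ gal φ hφ ^ k) x : invariants ρ gal) : (Fin m → E) ⊗[ℚ_[p]] B) =
      (phiTensor φ ^ k) (x : (Fin m → E) ⊗[ℚ_[p]] B) := by
  induction k with
  | zero => rw [pow_zero, pow_zero, Module.End.one_apply, Module.End.one_apply]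
  | succ k ih => rw [pow_succ', pow_succ', Module.End.mul_apply, Module.End.mul_apply, coe_phiD, ih]

/-- ★ **`φ_D^f = 1` on `D(𝟙_m) = (E^m ⊗_{ℚ_p} B)^Γ` as soon as `φ^f = id` on `B^Γ`**: `D(𝟙_m)` is the `E`-span of the
`e_k ⊗ w` with `w ∈ B^Γ` (Λ8a `invariants_eq_span_of_trivial`), and `(1 ⊗ φ)^f (e_k ⊗ w) = e_k ⊗ φ^f w = e_k ⊗ w`.
[cite: FontaineAsterisque223III, Exp. III §1.5] [cite: FontaineAsterisque223VIII, §2.3.7] -/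
theorem phiD_pow_eq_one_of_trivial {ρ : Γ → GL (Fin m) E} (hρ : ∀ σ, ρ σ = 1) (gal : Γ → (B →ₐ[ℚ_[p]] B))
    (φ : B →ₐ[ℚ_[p]] B) (hφ : ∀ σ, (gal σ).comp φ = φ.comp (gal σ)) {f : ℕ}
    (hfix : ∀ w : fixedSubalgebra gal, (φ : B → B)^[f] (w : B) = w) :
    phiD ρ gal φ hφ ^ f = 1 := by
  refine LinearMap.ext fun x => Subtype.ext ?_
  rw [coe_phiD_pow, Module.End.one_apply]
  have hx : (x : (Fin m → E) ⊗[ℚ_[p]] B) ∈ Submodule.span E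
      (Set.range fun kw : Fin m × fixedSubalgebra gal => (Pi.single kw.1 (1 : E) : Fin m → E) ⊗ₜ[ℚ_[p]] (kw.2 : B)) := by
    rw [← invariants_eq_span_of_trivial hρ gal]
    exact x.2
  have key : Set.EqOn (phiTensor (E := E) (m := m) φ ^ f) (1 : Module.End E ((Fin m → E) ⊗[ℚ_[p]] B))
      (Set.range fun kw : Fin m × fixedSubalgebra gal => (Pi.single kw.1 (1 : E) : Fin m → E) ⊗ₜ[ℚ_[p]] (kw.2 : B)) := by
    rintro _ ⟨kw, rfl⟩
    change (phiTensor (E := E) (m := m) φ ^ f) ((Pi.single kw.1 (1 : E) : Fin m → E) ⊗ₜ[ℚ_[p]] (kw.2 : B)) =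
      (1 : Module.End E ((Fin m → E) ⊗[ℚ_[p]] B)) ((Pi.single kw.1 (1 : E) : Fin m → E) ⊗ₜ[ℚ_[p]] (kw.2 : B))
    rw [phiTensor_pow_tmul, hfix, Module.End.one_apply]
  exact (LinearMap.eqOn_span key hx).trans (Module.End.one_apply _)

/-- `φ_D^f x = x` for every `x ∈ D(𝟙_m)`, when `φ^f = id` on `B^Γ`. [cite: FontaineAsterisque223III, Exp. III §1.5] -/
theorem phiD_pow_apply_of_trivial {ρ : Γ → GL (Fin m) E} (hρ : ∀ σ, ρ σ = 1) (gal : Γ → (B →ₐ[ℚ_[p]] B))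
    (φ : B →ₐ[ℚ_[p]] B) (hφ : ∀ σ, (gal σ).comp φ = φ.comp (gal σ)) {f : ℕ}
    (hfix : ∀ w : fixedSubalgebra gal, (φ : B → B)^[f] (w : B) = w) (x : invariants ρ gal) :
    (phiD ρ gal φ hφ ^ f) x = x := by
  rw [phiD_pow_eq_one_of_trivial hρ gal φ hφ hfix, Module.End.one_apply]

/-- **In every finite basis `b` of `D(𝟙_m)`, `charpoly (toMatrix b b (φ_D^f)) = (X - 1)^{|b|}`** when `φ^f = id`
on `B^Γ`. [cite: FontaineAsterisque223VIII, §2.3.7] -/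
theorem charpoly_toMatrix_phiD_pow_of_trivial {ρ : Γ → GL (Fin m) E} (hρ : ∀ σ, ρ σ = 1)
    (gal : Γ → (B →ₐ[ℚ_[p]] B)) (φ : B →ₐ[ℚ_[p]] B) (hφ : ∀ σ, (gal σ).comp φ = φ.comp (gal σ)) {f : ℕ}
    (hfix : ∀ w : fixedSubalgebra gal, (φ : B → B)^[f] (w : B) = w) {ι : Type*} [Fintype ι] [DecidableEq ι]
    (b : Module.Basis ι E (invariants ρ gal)) :
    (LinearMap.toMatrix b b (phiD ρ gal φ hφ ^ f)).charpoly = (X - 1) ^ Fintype.card ι := by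
  rw [phiD_pow_eq_one_of_trivial hρ gal φ hφ hfix, LinearMap.toMatrix_one, Matrix.charpoly_one]

end Abstract

/-! ### §2 The trivial Satake parameter -/

section Clause

variable {ℓ : ℕ} [Fact ℓ.Prime]

/-- **`geomFrobPolyOfSatake ι {1, …, 1} = (X - 1)^m`**: the predicted characteristic polynomial at the trivial
Satake parameter of size `m`. [cite: BuzzardGeeLMS2014, Conj. 3.2.1] -/
theorem geomFrobPolyOfSatake_replicate_one (ι : PadicAlgCl ℓ ≃+* ℂ) (m : ℕ) :
    geomFrobPolyOfSatake ι (Multiset.replicate m 1) = (X - 1) ^ m := by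
  simp only [geomFrobPolyOfSatake, Multiset.map_replicate, Multiset.prod_replicate, map_one]

/-- `geomFrobPolyOfSatake ι {1, …, 1} ^ f = (X - 1)^{m·f}`. [cite: BuzzardGeeLMS2014, Conj. 3.2.2] -/
theorem geomFrobPolyOfSatake_replicate_one_pow (ι : PadicAlgCl ℓ ≃+* ℂ) (m f : ℕ) :
    geomFrobPolyOfSatake ι (Multiset.replicate m 1) ^ f = (X - 1) ^ (m * f) := by
  rw [geomFrobPolyOfSatake_replicate_one, ← pow_mul]

end Clause

end D2Cris

/-! ### §3 `φ_D^f = 1` and `charpoly (φ_D^f) = (X - 1)^{m·f}` on `D_cris(𝟙_m)` over the constructed `B_max(F)` -/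

namespace SpecC

variable {F : Type} [Field F] [ValuativeRel F] [TopologicalSpace F] [IsNonarchimedeanLocalField F] [CharZero F]
  {p : ℕ} [Fact p.Prime] [Fact (¬ IsUnit (p : integerC F))] [IsAdicComplete (Ideal.span {(p : integerC F)}) (integerC F)]

/-- `φ` of `B_max(F)` as a `ℚ_p`-algebra map has underlying function `frobBmax`. [folklore] -/
theorem coe_frobBmaxAlgHom : ⇑(D2Cris.frobBmaxAlgHom F p) = D2Cris.frobBmax F p := rfl

section Main

variable [Fact (¬ IsUnit (p : maxUnramifiedCompletion F))] [CharP (IsLocalRing.ResidueField (maxUnramifiedCompletion F)) p]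
  (hp : valuation F p < 1) (hF : Function.Surjective (fontaineTheta (integerC F) p)) {m : ℕ}

include hp hF in
/-- ★ **`φ_D^f = 1` on `D_cris(𝟙_m)` over the constructed `B_max(F)`, for absolutely unramified `F`** (`p` a
uniformiser of `F`, `q_F = p^f`, `θ` surjective): `φ^f = id` on `B_max(F)^{Γ_F} = K₀` (Λ9) and §1.
[cite: FontaineAsterisque223VIII, §2.3.7] [cite: Colmez1998Annals, §III.2] -/
theorem phiDcris_pow_eq_one_of_unramified (hur : Irreducible (p : 𝒪[F])) {f : ℕ} (hq : residueFieldCard F = p ^ f) :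
    D2Cris.phiDcris (F := F) (p := p) (1 : FramedRep (absoluteGaloisGroup F) (PadicAlgCl p) m) ^ f = 1 :=
  D2Cris.phiD_pow_eq_one_of_trivial (ρ := ⇑(1 : FramedRep (absoluteGaloisGroup F) (PadicAlgCl p) m)) (fun _ => rfl)
    (D2Cris.galBmaxAlgHom (F := F) (p := p)) (D2Cris.frobBmaxAlgHom F p) D2Cris.galBmaxAlgHom_comp_frobBmaxAlgHom
    fun w => by
      rw [coe_frobBmaxAlgHom]
      exact frobBmax_iterate_eq_self_of_unramified hp hF hur hq (forall_galBmax_coe w)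

include hp hF in
/-- **`φ_D^f x = x` for every `x ∈ D_cris(𝟙_m)`**, absolutely unramified `F`. [cite: FontaineAsterisque223VIII, §2.3.7] -/
theorem phiDcris_pow_apply_of_unramified (hur : Irreducible (p : 𝒪[F])) {f : ℕ} (hq : residueFieldCard F = p ^ f)
    (x : D2Cris.Dcris (F := F) (p := p) (1 : FramedRep (absoluteGaloisGroup F) (PadicAlgCl p) m)) :
    (D2Cris.phiDcris (1 : FramedRep (absoluteGaloisGroup F) (PadicAlgCl p) m) ^ f) x = x := by
  rw [phiDcris_pow_eq_one_of_unramified hp hF hur hq, Module.End.one_apply]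

include hp hF in
/-- **`φ_D^[f] x = x` for every `x ∈ D_cris(𝟙_m)`** (iterate form, extending `D2Cris.phiDcris_iterate_teichVector_eq_self`
from the Teichmüller vectors to all of `D_cris(𝟙_m)`), absolutely unramified `F`. [cite: FontaineAsterisque223VIII, §2.3.7] -/
theorem phiDcris_iterate_eq_self_of_unramified (hur : Irreducible (p : 𝒪[F])) {f : ℕ}
    (hq : residueFieldCard F = p ^ f)
    (x : D2Cris.Dcris (F := F) (p := p) (1 : FramedRep (absoluteGaloisGroup F) (PadicAlgCl p) m)) :
    (D2Cris.phiDcris (1 : FramedRep (absoluteGaloisGroup F) (PadicAlgCl p) m))^[f] x = x := by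
  rw [← Module.End.pow_apply, phiDcris_pow_apply_of_unramified hp hF hur hq]

include hp hF in
/-- **In every finite basis `b` of `D_cris(𝟙_m)`, `charpoly (toMatrix b b (φ_D^f)) = (X - 1)^{|b|}`**, absolutely
unramified `F`. [cite: FontaineAsterisque223VIII, §2.3.7] -/
theorem charpoly_toMatrix_phiDcris_pow_of_unramified (hur : Irreducible (p : 𝒪[F])) {f : ℕ}
    (hq : residueFieldCard F = p ^ f) {ι : Type*} [Fintype ι] [DecidableEq ι]
    (b : Module.Basis ι (PadicAlgCl p) (D2Cris.Dcris (F := F) (p := p) (1 : FramedRep (absoluteGaloisGroup F) (PadicAlgCl p) m))) :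
    (LinearMap.toMatrix b b (D2Cris.phiDcris (1 : FramedRep (absoluteGaloisGroup F) (PadicAlgCl p) m) ^ f)).charpoly =
      (X - 1) ^ Fintype.card ι := by
  rw [phiDcris_pow_eq_one_of_unramified hp hF hur hq, LinearMap.toMatrix_one, Matrix.charpoly_one]

include hp hF in
/-- ★★ **The `𝟙_m` instance of the conclusion of `CrystallineCompatibleAt` at an absolutely unramified place**: for `p`
a uniformiser of `F`, `q_F = p^f` and `θ` surjective, `D_cris(𝟙_m)` over the constructed `B_max(F)` has a `ℚ̄_p`-basis
of size `m · f` (Λ9 `finrank_Dcris_one_eq_of_unramified`) in which `charpoly (φ_D^f) = (X - 1)^{m·f}`.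
[cite: BuzzardGeeLMS2014, Conj. 3.2.2] [cite: FontaineAsterisque223VIII, §2.3.7] -/
theorem exists_basis_charpoly_phiDcris_pow_of_unramified (hur : Irreducible (p : 𝒪[F])) {f : ℕ}
    (hq : residueFieldCard F = p ^ f) :
    ∃ b : Module.Basis (Fin (m * f)) (PadicAlgCl p)
        (D2Cris.Dcris (F := F) (p := p) (1 : FramedRep (absoluteGaloisGroup F) (PadicAlgCl p) m)),
      (LinearMap.toMatrix b b (D2Cris.phiDcris (1 : FramedRep (absoluteGaloisGroup F) (PadicAlgCl p) m) ^ f)).charpoly =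
        (X - 1) ^ (m * f) := by
  haveI := finite_Dcris_one hp hF (m := m)
  haveI : Module.Free (PadicAlgCl p)
      (D2Cris.Dcris (F := F) (p := p) (1 : FramedRep (absoluteGaloisGroup F) (PadicAlgCl p) m)) :=
    Module.Free.of_divisionRing (PadicAlgCl p)
      (D2Cris.Dcris (F := F) (p := p) (1 : FramedRep (absoluteGaloisGroup F) (PadicAlgCl p) m))
  refine ⟨Module.finBasisOfFinrankEq (PadicAlgCl p)
    (D2Cris.Dcris (F := F) (p := p) (1 : FramedRep (absoluteGaloisGroup F) (PadicAlgCl p) m))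
    (finrank_Dcris_one_eq_of_unramified hp hF hur hq), ?_⟩
  rw [charpoly_toMatrix_phiDcris_pow_of_unramified hp hF hur hq, Fintype.card_fin]

include hp hF in
/-- ★★ **The same, literally in the currency of the clause**: a basis of size `m · f` with
`charpoly (toMatrix b b (φ_D ^ f)) = geomFrobPolyOfSatake ι {1, …, 1} ^ f` (any `ι : ℚ̄_p ≃ ℂ`).
[cite: BuzzardGeeLMS2014, Conj. 3.2.2] -/
theorem exists_basis_charpoly_eq_geomFrobPolyOfSatake_pow_of_unramified (hur : Irreducible (p : 𝒪[F])) {f : ℕ}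
    (hq : residueFieldCard F = p ^ f) (ι : PadicAlgCl p ≃+* ℂ) :
    ∃ b : Module.Basis (Fin (m * f)) (PadicAlgCl p)
        (D2Cris.Dcris (F := F) (p := p) (1 : FramedRep (absoluteGaloisGroup F) (PadicAlgCl p) m)),
      (LinearMap.toMatrix b b (D2Cris.phiDcris (1 : FramedRep (absoluteGaloisGroup F) (PadicAlgCl p) m) ^ f)).charpoly =
        D2Cris.geomFrobPolyOfSatake ι (Multiset.replicate m 1) ^ f := by
  rw [D2Cris.geomFrobPolyOfSatake_replicate_one_pow]
  exact exists_basis_charpoly_phiDcris_pow_of_unramified hp hF hur hq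

end Main

/-! ### §4 Input-free forms: `θ` surjective and the `F^nr` instance facts discharged from `valuation F p < 1` -/

section InputFree

variable (hp : valuation F p < 1) {m : ℕ}

include hp in
/-- ★ **`φ_D^f = 1` on `D_cris(𝟙_m)` for every absolutely unramified `p`-adic field `F`, input-free.**
[cite: FontaineAsterisque223VIII, §2.3.7] -/
theorem phiDcris_pow_eq_one_of_unramified' (hur : Irreducible (p : 𝒪[F])) {f : ℕ} (hq : residueFieldCard F = p ^ f) :
    D2Cris.phiDcris (F := F) (p := p) (1 : FramedRep (absoluteGaloisGroup F) (PadicAlgCl p) m) ^ f = 1 := by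
  haveI : Fact (¬ IsUnit (p : maxUnramifiedCompletion F)) := ⟨not_isUnit_natCast_completion hp⟩
  haveI : CharP (IsLocalRing.ResidueField (maxUnramifiedCompletion F)) p := charP_residueField_completion
  exact phiDcris_pow_eq_one_of_unramified hp (surjective_fontaineTheta_integerC hp) hur hq

include hp in
/-- ★★ **The `𝟙_m` instance of the conclusion of `CrystallineCompatibleAt`, input-free**: for every absolutely
unramified `p`-adic field `F` (`p` a uniformiser, `q_F = p^f`) a `ℚ̄_p`-basis of `D_cris(𝟙_m)` of size `m · f` with
`charpoly (φ_D^f) = (X - 1)^{m·f}`. [cite: BuzzardGeeLMS2014, Conj. 3.2.2] [cite: FontaineAsterisque223VIII, §2.3.7] -/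
theorem exists_basis_charpoly_phiDcris_pow_of_unramified' (hur : Irreducible (p : 𝒪[F])) {f : ℕ}
    (hq : residueFieldCard F = p ^ f) :
    ∃ b : Module.Basis (Fin (m * f)) (PadicAlgCl p)
        (D2Cris.Dcris (F := F) (p := p) (1 : FramedRep (absoluteGaloisGroup F) (PadicAlgCl p) m)),
      (LinearMap.toMatrix b b (D2Cris.phiDcris (1 : FramedRep (absoluteGaloisGroup F) (PadicAlgCl p) m) ^ f)).charpoly =
        (X - 1) ^ (m * f) := by
  haveI : Fact (¬ IsUnit (p : maxUnramifiedCompletion F)) := ⟨not_isUnit_natCast_completion hp⟩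
  haveI : CharP (IsLocalRing.ResidueField (maxUnramifiedCompletion F)) p := charP_residueField_completion
  exact exists_basis_charpoly_phiDcris_pow_of_unramified hp (surjective_fontaineTheta_integerC hp) hur hq

include hp in
/-- ★★ **Input-free, in the currency of the clause**: `charpoly (toMatrix b b (φ_D ^ f)) = geomFrobPolyOfSatake ι {1,…,1} ^ f`
on a basis of size `m · f`, for every absolutely unramified `F` and every `ι : ℚ̄_p ≃ ℂ`. [cite: BuzzardGeeLMS2014, Conj. 3.2.2] -/
theorem exists_basis_charpoly_eq_geomFrobPolyOfSatake_pow_of_unramified' (hur : Irreducible (p : 𝒪[F])) {f : ℕ}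
    (hq : residueFieldCard F = p ^ f) (ι : PadicAlgCl p ≃+* ℂ) :
    ∃ b : Module.Basis (Fin (m * f)) (PadicAlgCl p)
        (D2Cris.Dcris (F := F) (p := p) (1 : FramedRep (absoluteGaloisGroup F) (PadicAlgCl p) m)),
      (LinearMap.toMatrix b b (D2Cris.phiDcris (1 : FramedRep (absoluteGaloisGroup F) (PadicAlgCl p) m) ^ f)).charpoly =
        D2Cris.geomFrobPolyOfSatake ι (Multiset.replicate m 1) ^ f := by
  rw [D2Cris.geomFrobPolyOfSatake_replicate_one_pow]
  exact exists_basis_charpoly_phiDcris_pow_of_unramified' hp hur hq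

end InputFree

end SpecC

end Summit.Langlands.Langlands.Theorems

end
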